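import Summits.QuantumFields.YangMills.Theorems.FluctuationComparisonRegPrIntLHaarTubeLscFloor
import HarnessLib

/-!
# `FluctuationComparisonRegPrIntLChartTargetLscFloor` — THE CONSTANT-TARGET EDITION OF THE L.S.C.-FLOOR ENGINE: for a window chart and a FIXED OPEN target `G`,
# the charge `U ↦ κ_U(Sfine ∩ G) = ∫⁻ 1_{Sfine ∩ G}(c.Φ(U,z))·c.jac(U,z) dU_K(z)` is lower semicontinuous on the chart domain and has ONE positive floor on every
# compact set where it is positive (crux `FluctuationComparisonRegPrIntL`, stmt-QuantumFields-20520; LINE g22-4 ∕ g22-5, rows PERS₁∘ ∕ TUBE∘ — the ⟨SMALL-MASS₁⟩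
# chart road (ii)–(iv) of px8 g14's (A1″) and LEAD w3-20520 g18's σ-free PERS₁∘ knit)

Cell `ym3-torus` (YM ladder rung R3 = continuum SU(2) Yang–Mills on T³ — a RUNG, NOT d = 4, NOT infinite volume, NOT a mass gap, NOT Clay);
width seat `ym-ust-20520-w4` (gen 18), explicit-unit helper; `--supports stmt-QuantumFields-20520 --as helper`.  THEOREMS ONLY (0 `def`, 0 `sorry`,
default heartbeats).  Sibling of ✓`…HaarTubeLscFloor` (p764381), whose §4–§5 are lettered for the TUBE family `Sfine ∩ tube_r(x)`; LEAD w3-20520 g18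
06:48:27Z asked for the GENERAL (constant, open) target — this file.

* §1 ★★ `ae_lowerSemicontinuousAt_targetIntegrand` — for `c : WindowChart F hJK Sfine O`, `U₀ ∈ O`, `G` open: for `dU_K`-a.e. `z` the integrand
  `U ↦ 1_{Sfine ∩ G}(c.Φ(U,z))·c.jac(U,z)` is l.s.c. at `U₀` — from the chart's `regular` field ALONE (live branch: a non-zero value forces `c.Φ(U₀,z) ∈ interior Sfine ∩ G`,
  a neighbourhood; dead branch ∕ `jac = 0`: value `0`); `measurable_targetIntegrand`; ★★★ `lowerSemicontinuousOn_targetCharge` — `U ↦ κ_U(Sfine ∩ G)` is l.s.c. on `O`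
  (✓`lowerSemicontinuousOn_lintegral`).
* §2 ★★★ `exists_pos_le_targetCharge` — on a compact `K ⊆ O` where `κ_U(Sfine ∩ G) > 0`, ONE `m > 0` with `m ≤ κ_U(Sfine ∩ G)` on `K` (the ABSOLUTE floor; the
  denominator `dU_{J+1}(D⁻¹B) ≤ C′·dU_J(B)` is a separate letter, UFL₁); ★★ `exists_floor_targetCharge_of_pos` — the RELATIVE twin `ofReal q·∫⁻ c.jac(U,z) ≤
  ∫⁻ 1_G(c.Φ(U,z))·c.jac(U,z)` on `K` (= the `hfib` of ✓`…HaarTubeOneStep.haar_preimage_inter_target_of_windowChart` for the constant family `E U := G`, pointwise on `K`).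
* §4 ★★★ `exists_numFib_of_pos` — the a.e.-on-`O ∩ W` numerator-floor letter `ofReal m ≤ ∫⁻ 1_{G ∩ Sfine}(c.Φ(U,z))·c.jac(U,z)` of px8 g14's
  `…SmallMassOneStep.numFloor_of_chartwise`, token-for-token, from a pointwise charge on a compact datum set `Kc ⊇ O ∩ W`.
* §3 `pos_targetCharge_of_measure_pos` (positive Haar mass of the live set `{jac ≠ 0 ∧ Φ ∈ Sfine ∩ G}` ⟹ positive charge) and, at `G = univ`,
  ★★ `pos_sfineCharge_of_charge` — the interface's `charge` field READ AS the pointwise positivity of `κ_V(Sfine)` at every `V ∈ O` whose fibre meets `interior Sfine`;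
  ★★★ `exists_pos_le_sfineCharge_of_charge` — hence ONE floor `m > 0` of `κ_V(Sfine)` on every compact `K ⊆ O` all of whose fibres meet `interior Sfine`
  (that fibre condition is GEOMfib∘ ∕ the W7 lift's interior preimage — DISPLAYED, not proved here).

HONEST SCOPE.  Topology∕measure plumbing over landed objects; nothing of Bałaban's asserted; ⟨SMALL-MASS₁⟩, UFL₁, ⟨HAAR-TUBE₁⟩, ⟨UP⟩, ⟨LOW⟩, TUBE∘, PERS₁∘, LFR♯ᶜ∘,
S2β, the crux 20520 and every rung statement are NOT proved; `YM3TorusSU2` NOT proved; the Yang–Mills mass gap (Clay) NOT proved.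

References: T. Bałaban, Commun. Math. Phys. **98** (1985) 17–51 [Balaban1985Averaging] ((10) p. 19, Prop. 1 p. 22); CMP **109** (1987) 249–301
[Balaban1987RG1] ((0.13) p. 254, (2.10) p. 267); CMP **102** (1985) 255–275 [Balaban1985UV3] ((7) p. 257).
-/

set_option autoImplicit false

noncomputable section

open MeasureTheory Filter Topology Set
open scoped ENNReal NNReal
open Literature.MathematicalPhysics.QuantumFieldTheory.Balaban1983to89
open Literature.MathematicalPhysics.QuantumFieldTheory.Balaban1983to89.T3ContinuumYM3Torus
open Literature.MathematicalPhysics.QuantumFieldTheory.Balaban1983to89.T3UnitLawDensityEML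
open Literature.MathematicalPhysics.QuantumFieldTheory.Balaban1983to89.T3TiltDescent
open scoped Literature.MathematicalPhysics.QuantumFieldTheory.Balaban1983to89.T3OrbitAverage
open Summit.QuantumFields.YangMills.Theorems.FluctuationComparisonRegPrIntLWregGlue (WindowChart)
open Summit.QuantumFields.YangMills.Theorems.FluctuationComparisonRegPrIntLHaarTubeLscFloor

namespace Summit.QuantumFields.YangMills.Theorems.FluctuationComparisonRegPrIntLChartTargetLscFloor

variable (F : T3Family) {J K : ℕ} (hJK : J ≤ K)
  {Sfine : Set (GaugeField (F.P K) 0 (Matrix.specialUnitaryGroup (Fin 2) ℂ))}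
  {O : Set (GaugeField (F.P J) 0 (Matrix.specialUnitaryGroup (Fin 2) ℂ))}

/-! ## §1 The constant-target charge is lower semicontinuous on the chart domain -/

/-- ★★ **A.E.-LEAFWISE L.S.C. OF THE CONSTANT-TARGET INTEGRAND** (from `c.regular` alone): for a window chart `c`, `U₀ ∈ O` and an OPEN target `G`, for `dU_K`-a.e. `z`
the map `U ↦ 1_{Sfine ∩ G}(c.Φ(U,z))·c.jac(U,z)` is l.s.c. at `U₀`: on the regular branch with `c.jac(U₀,z) ≠ 0` a non-zero value forces `c.Φ(U₀,z) ∈ Sfine ∖ frontier Sfine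
= interior Sfine` and `∈ G`, so `interior Sfine ∩ G` is a neighbourhood on which the indicator is `1`, and `c.jac(·,z)` is continuous; otherwise the value at `U₀` is `0`.
[cite: Balaban1987RG1, (0.13) p.254 (bookkeeping); Balaban1985Averaging, (10) p.19] -/
theorem ae_lowerSemicontinuousAt_targetIntegrand (c : WindowChart F hJK Sfine O) {U₀ : GaugeField (F.P J) 0 (Matrix.specialUnitaryGroup (Fin 2) ℂ)}
    (hU₀ : U₀ ∈ O) {G : Set (GaugeField (F.P K) 0 (Matrix.specialUnitaryGroup (Fin 2) ℂ))} (hG : IsOpen G) :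
    ∀ᵐ z ∂(fieldMeasure (F.P K) 0 (Matrix.specialUnitaryGroup (Fin 2) ℂ)),
      LowerSemicontinuousAt (fun U : GaugeField (F.P J) 0 (Matrix.specialUnitaryGroup (Fin 2) ℂ) =>
        (Sfine ∩ G).indicator (fun _ => (1 : ℝ≥0∞)) (c.Φ (U, z)) * (c.jac (U, z) : ℝ≥0∞)) U₀ := by
  filter_upwards [c.regular U₀ hU₀] with z hz
  have triv : (Sfine ∩ G).indicator (fun _ => (1 : ℝ≥0∞)) (c.Φ (U₀, z)) * (c.jac (U₀, z) : ℝ≥0∞) = 0 →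
      LowerSemicontinuousAt (fun U : GaugeField (F.P J) 0 (Matrix.specialUnitaryGroup (Fin 2) ℂ) =>
        (Sfine ∩ G).indicator (fun _ => (1 : ℝ≥0∞)) (c.Φ (U, z)) * (c.jac (U, z) : ℝ≥0∞)) U₀ := by
    intro h0 y hy
    exact absurd (hy.trans_le (le_of_eq h0)) ENNReal.not_lt_zero
  rcases hz with ⟨hj, hΦ, hfr⟩ | hev
  · by_cases h0 : c.jac (U₀, z) = 0
    · exact triv (by simp [h0])
    · refine lowerSemicontinuousAt_indicator_comp_mul ?_ hΦ ?_
      · rintro ⟨hS, hGm⟩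
        have hint : c.Φ (U₀, z) ∈ interior Sfine := by
          rw [← closure_sdiff_frontier Sfine]
          exact ⟨subset_closure hS, hfr h0⟩
        refine Filter.mem_of_superset ((isOpen_interior.inter hG).mem_nhds ⟨hint, hGm⟩) ?_
        rintro w ⟨hw1, hw2⟩
        exact ⟨interior_subset hw1, hw2⟩
      · have hj' : ContinuousAt (fun V => c.jac (V, z)) U₀ := NNReal.tendsto_coe.mp hj
        have hj'' : ContinuousAt (fun V => (c.jac (V, z) : ℝ≥0∞)) U₀ := ENNReal.continuous_coe.continuousAt.comp hj'
        exact (continuousAt_iff_lower_upperSemicontinuousAt.mp hj'').1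
  · rcases hev.self_of_nhds with h0 | hnS
    · exact triv (by simp [h0])
    · exact triv (by simp [Set.indicator_of_notMem (fun h : c.Φ (U₀, z) ∈ Sfine ∩ G => hnS h.1)])

/-- **Measurability of every leaf of the constant-target integrand** (`Sfine`, `G` measurable). [folklore] -/
theorem measurable_targetIntegrand (c : WindowChart F hJK Sfine O) (hS : MeasurableSet Sfine)
    {G : Set (GaugeField (F.P K) 0 (Matrix.specialUnitaryGroup (Fin 2) ℂ))} (hGm : MeasurableSet G)
    (U : GaugeField (F.P J) 0 (Matrix.specialUnitaryGroup (Fin 2) ℂ)) :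
    Measurable fun z => (Sfine ∩ G).indicator (fun _ => (1 : ℝ≥0∞)) (c.Φ (U, z)) * (c.jac (U, z) : ℝ≥0∞) :=
  ((measurable_const.indicator (hS.inter hGm)).comp (c.measurable_Φ.comp measurable_prodMk_left)).mul
    (measurable_coe_nnreal_ennreal.comp (c.measurable_jac.comp measurable_prodMk_left))

/-- ★★★ **THE CONSTANT-TARGET CHARGE IS LOWER SEMICONTINUOUS ON THE CHART DOMAIN**: for `Sfine` measurable and `G` open, `U ↦ ∫⁻ 1_{Sfine ∩ G}(c.Φ(U,z))·c.jac(U,z) dU_K(z)`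
is l.s.c. on `O` (§1 + ✓`lowerSemicontinuousOn_lintegral`). [cite: Balaban1987RG1, (0.13) p.254 (bookkeeping); Balaban1985Averaging, (10) p.19 and Prop. 1 p.22] -/
theorem lowerSemicontinuousOn_targetCharge (c : WindowChart F hJK Sfine O) (hS : MeasurableSet Sfine)
    {G : Set (GaugeField (F.P K) 0 (Matrix.specialUnitaryGroup (Fin 2) ℂ))} (hG : IsOpen G) :
    LowerSemicontinuousOn (fun U : GaugeField (F.P J) 0 (Matrix.specialUnitaryGroup (Fin 2) ℂ) =>
      ∫⁻ z, (Sfine ∩ G).indicator (fun _ => (1 : ℝ≥0∞)) (c.Φ (U, z)) * (c.jac (U, z) : ℝ≥0∞) ∂(fieldMeasure (F.P K) 0 (Matrix.specialUnitaryGroup (Fin 2) ℂ))) O :=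
  lowerSemicontinuousOn_lintegral (fun U => (measurable_targetIntegrand F hJK c hS hG.measurableSet U).aemeasurable)
    fun _ hU₀ => ae_lowerSemicontinuousAt_targetIntegrand F hJK c hU₀ hG

/-! ## §2 One floor on a compact set where the charge is positive -/

/-- ★★★ **ABSOLUTE FLOOR OF THE CONSTANT-TARGET CHARGE**: `K ⊆ O` compact and `κ_U(Sfine ∩ G) > 0` on `K` ⟹ ONE `m > 0` with `m ≤ κ_U(Sfine ∩ G)` for every `U ∈ K`
(✓`exists_pos_le_of_lowerSemicontinuousOn`).  The positivity `hpos` is the HYPOTHESIS (for `G = univ` it is the chart's `charge`, §3).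
[cite: Balaban1985Averaging, (10) p.19 and Prop. 1 p.22; Balaban1987RG1, (2.10) p.267] -/
theorem exists_pos_le_targetCharge (c : WindowChart F hJK Sfine O) (hS : MeasurableSet Sfine)
    {G : Set (GaugeField (F.P K) 0 (Matrix.specialUnitaryGroup (Fin 2) ℂ))} (hG : IsOpen G)
    {Kc : Set (GaugeField (F.P J) 0 (Matrix.specialUnitaryGroup (Fin 2) ℂ))} (hK : IsCompact Kc) (hKO : Kc ⊆ O)
    (hpos : ∀ U ∈ Kc, 0 < ∫⁻ z, (Sfine ∩ G).indicator (fun _ => (1 : ℝ≥0∞)) (c.Φ (U, z)) * (c.jac (U, z) : ℝ≥0∞)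
      ∂(fieldMeasure (F.P K) 0 (Matrix.specialUnitaryGroup (Fin 2) ℂ))) :
    ∃ m : ℝ≥0∞, 0 < m ∧ ∀ U ∈ Kc, m ≤ ∫⁻ z, (Sfine ∩ G).indicator (fun _ => (1 : ℝ≥0∞)) (c.Φ (U, z)) * (c.jac (U, z) : ℝ≥0∞)
      ∂(fieldMeasure (F.P K) 0 (Matrix.specialUnitaryGroup (Fin 2) ℂ)) :=
  exists_pos_le_of_lowerSemicontinuousOn hK ((lowerSemicontinuousOn_targetCharge F hJK c hS hG).mono hKO) hpos

/-- ★★ **RELATIVE FLOOR OF THE CONSTANT-TARGET CHARGE**: same data ⟹ ONE real `q > 0` with `ofReal q·∫⁻ c.jac(U,z) ≤ ∫⁻ 1_G(c.Φ(U,z))·c.jac(U,z)` for every `U ∈ K`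
(`∫⁻ jac ≤ c.bound`, Haar a probability measure; `q := min(m,1)∕(c.bound+1)`) — pointwise on `K` the `hfib` letter of ✓`…HaarTubeOneStep.haar_preimage_inter_target_of_windowChart`
for the constant target family `E U := G`. [cite: Balaban1985Averaging, (10) p.19 and Prop. 1 p.22; Balaban1987RG1, (2.10) p.267] -/
theorem exists_floor_targetCharge_of_pos (c : WindowChart F hJK Sfine O) (hS : MeasurableSet Sfine)
    {G : Set (GaugeField (F.P K) 0 (Matrix.specialUnitaryGroup (Fin 2) ℂ))} (hG : IsOpen G)
    {Kc : Set (GaugeField (F.P J) 0 (Matrix.specialUnitaryGroup (Fin 2) ℂ))} (hK : IsCompact Kc) (hKO : Kc ⊆ O)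
    (hpos : ∀ U ∈ Kc, 0 < ∫⁻ z, (Sfine ∩ G).indicator (fun _ => (1 : ℝ≥0∞)) (c.Φ (U, z)) * (c.jac (U, z) : ℝ≥0∞)
      ∂(fieldMeasure (F.P K) 0 (Matrix.specialUnitaryGroup (Fin 2) ℂ))) :
    ∃ q : ℝ, 0 < q ∧ ∀ U ∈ Kc,
      ENNReal.ofReal q * ∫⁻ z, (c.jac (U, z) : ℝ≥0∞) ∂(fieldMeasure (F.P K) 0 (Matrix.specialUnitaryGroup (Fin 2) ℂ)) ≤
        ∫⁻ z, G.indicator (fun _ => (1 : ℝ≥0∞)) (c.Φ (U, z)) * (c.jac (U, z) : ℝ≥0∞) ∂(fieldMeasure (F.P K) 0 (Matrix.specialUnitaryGroup (Fin 2) ℂ)) := by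
  obtain ⟨m, hm, hle⟩ := exists_pos_le_targetCharge F hJK c hS hG hK hKO hpos
  have hfin : min m 1 ≠ ∞ := ne_top_of_le_ne_top ENNReal.one_ne_top (min_le_right _ _)
  have hpos' : 0 < min m 1 := lt_min hm one_pos
  have hb1 : (0 : ℝ) < (c.bound : ℝ) + 1 := by positivity
  refine ⟨(min m 1).toReal / ((c.bound : ℝ) + 1), div_pos (ENNReal.toReal_pos hpos'.ne' hfin) hb1, fun U hU => ?_⟩
  have hq : ENNReal.ofReal ((min m 1).toReal / ((c.bound : ℝ) + 1)) * (c.bound : ℝ≥0∞) ≤ min m 1 := by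
    have hcb : (c.bound : ℝ≥0∞) = ENNReal.ofReal (c.bound : ℝ) := by rw [ENNReal.ofReal_coe_nnreal]
    rw [hcb, ← ENNReal.ofReal_mul (div_nonneg ENNReal.toReal_nonneg hb1.le)]
    calc ENNReal.ofReal ((min m 1).toReal / ((c.bound : ℝ) + 1) * (c.bound : ℝ))
        ≤ ENNReal.ofReal ((min m 1).toReal / ((c.bound : ℝ) + 1) * ((c.bound : ℝ) + 1)) := by
          gcongr
          linarith
      _ = ENNReal.ofReal ((min m 1).toReal) := by rw [div_mul_cancel₀ _ hb1.ne']
      _ = min m 1 := ENNReal.ofReal_toReal hfin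
  have hmono : ∫⁻ z, (Sfine ∩ G).indicator (fun _ => (1 : ℝ≥0∞)) (c.Φ (U, z)) * (c.jac (U, z) : ℝ≥0∞)
        ∂(fieldMeasure (F.P K) 0 (Matrix.specialUnitaryGroup (Fin 2) ℂ)) ≤
      ∫⁻ z, G.indicator (fun _ => (1 : ℝ≥0∞)) (c.Φ (U, z)) * (c.jac (U, z) : ℝ≥0∞) ∂(fieldMeasure (F.P K) 0 (Matrix.specialUnitaryGroup (Fin 2) ℂ)) :=
    lintegral_mono fun z => mul_le_mul' (Set.indicator_le_indicator_of_subset Set.inter_subset_right (fun _ => zero_le) _) le_rfl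
  calc ENNReal.ofReal ((min m 1).toReal / ((c.bound : ℝ) + 1)) * ∫⁻ z, (c.jac (U, z) : ℝ≥0∞) ∂(fieldMeasure (F.P K) 0 (Matrix.specialUnitaryGroup (Fin 2) ℂ))
      ≤ ENNReal.ofReal ((min m 1).toReal / ((c.bound : ℝ) + 1)) * (c.bound : ℝ≥0∞) := mul_le_mul' le_rfl (lintegral_jac_le_bound F hJK c U)
    _ ≤ min m 1 := hq
    _ ≤ m := min_le_left _ _
    _ ≤ _ := hle U hU
    _ ≤ _ := hmono

/-! ## §3 Pointwise positivity: from a positive live mass, and from the interface's `charge` field -/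

/-- **POSITIVE LIVE MASS ⟹ POSITIVE CONSTANT-TARGET CHARGE**: if `{z | c.jac (U,z) ≠ 0 ∧ c.Φ (U,z) ∈ Sfine ∩ G}` has positive Haar mass then `κ_U(Sfine ∩ G) > 0`
(that set is the support of the integrand; ✓`lintegral_pos_iff_support`). [cite: Balaban1985Averaging, (10) p.19 and Prop. 1 p.22] -/
theorem pos_targetCharge_of_measure_pos (c : WindowChart F hJK Sfine O) (hS : MeasurableSet Sfine)
    {G : Set (GaugeField (F.P K) 0 (Matrix.specialUnitaryGroup (Fin 2) ℂ))} (hGm : MeasurableSet G)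
    (U : GaugeField (F.P J) 0 (Matrix.specialUnitaryGroup (Fin 2) ℂ))
    (h : 0 < fieldMeasure (F.P K) 0 (Matrix.specialUnitaryGroup (Fin 2) ℂ) {z | c.jac (U, z) ≠ 0 ∧ c.Φ (U, z) ∈ Sfine ∩ G}) :
    0 < ∫⁻ z, (Sfine ∩ G).indicator (fun _ => (1 : ℝ≥0∞)) (c.Φ (U, z)) * (c.jac (U, z) : ℝ≥0∞) ∂(fieldMeasure (F.P K) 0 (Matrix.specialUnitaryGroup (Fin 2) ℂ)) := by
  rw [lintegral_pos_iff_support (measurable_targetIntegrand F hJK c hS hGm U)]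
  refine h.trans_le (measure_mono ?_)
  rintro z ⟨hj, hΦ⟩
  rw [Function.mem_support, Set.indicator_of_mem hΦ, one_mul]
  exact ENNReal.coe_ne_zero.mpr hj

/-- ★★ **THE INTERFACE'S `charge` FIELD AS POINTWISE POSITIVITY OF `κ_V(Sfine)`**: for a window chart `c` and `V ∈ O` whose fibre meets `interior Sfine`
(`∃ U, D U = V ∧ U ∈ interior Sfine` — GEOMfib∘ ∕ the W7 lift's interior preimage supplies it), `0 < ∫⁻ 1_{Sfine}(c.Φ(V,z))·c.jac(V,z) dU_K(z)` (`c.charge` + §3 at `G = univ`).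
[cite: Balaban1987RG1, (2.10) p.267; Balaban1985Averaging, Prop. 1 p.22] -/
theorem pos_sfineCharge_of_charge (c : WindowChart F hJK Sfine O) (hS : MeasurableSet Sfine)
    {V : GaugeField (F.P J) 0 (Matrix.specialUnitaryGroup (Fin 2) ℂ)} (hV : V ∈ O)
    (hint : ∃ U : GaugeField (F.P K) 0 (Matrix.specialUnitaryGroup (Fin 2) ℂ), descendTo F ℰp J K hJK U = V ∧ U ∈ interior Sfine) :
    0 < ∫⁻ z, Sfine.indicator (fun _ => (1 : ℝ≥0∞)) (c.Φ (V, z)) * (c.jac (V, z) : ℝ≥0∞) ∂(fieldMeasure (F.P K) 0 (Matrix.specialUnitaryGroup (Fin 2) ℂ)) := by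
  have h := pos_targetCharge_of_measure_pos F hJK c hS MeasurableSet.univ V (G := Set.univ)
    (by simpa only [Set.inter_univ] using c.charge V hV hint)
  simpa only [Set.inter_univ] using h

/-- ★★★ **ONE FLOOR OF `κ_V(Sfine)` ON A COMPACT SET OF DATA WHOSE FIBRES MEET `interior Sfine`** (px8 g14's (A1″) road (ii)–(iv) in one line): `K ⊆ O` compact, every
`V ∈ K` has a fibre point in `interior Sfine` ⟹ `∃ m > 0, ∀ V ∈ K, m ≤ ∫⁻ 1_{Sfine}(c.Φ(V,z))·c.jac(V,z) dU_K(z)`.  The fibre condition is DISPLAYED (GEOMfib∘), the denominator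
letter UFL₁ is separate; ⟨SMALL-MASS₁⟩ itself is NOT concluded here (its door is px8's). [cite: Balaban1985Averaging, (10) p.19 and Prop. 1 p.22; Balaban1987RG1, (2.10) p.267] -/
theorem exists_pos_le_sfineCharge_of_charge (c : WindowChart F hJK Sfine O) (hS : MeasurableSet Sfine)
    {Kc : Set (GaugeField (F.P J) 0 (Matrix.specialUnitaryGroup (Fin 2) ℂ))} (hK : IsCompact Kc) (hKO : Kc ⊆ O)
    (hint : ∀ V ∈ Kc, ∃ U : GaugeField (F.P K) 0 (Matrix.specialUnitaryGroup (Fin 2) ℂ), descendTo F ℰp J K hJK U = V ∧ U ∈ interior Sfine) :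
    ∃ m : ℝ≥0∞, 0 < m ∧ ∀ V ∈ Kc, m ≤ ∫⁻ z, Sfine.indicator (fun _ => (1 : ℝ≥0∞)) (c.Φ (V, z)) * (c.jac (V, z) : ℝ≥0∞)
      ∂(fieldMeasure (F.P K) 0 (Matrix.specialUnitaryGroup (Fin 2) ℂ)) := by
  have h := exists_pos_le_targetCharge F hJK c hS isOpen_univ hK hKO (G := Set.univ) (fun V hV => by
    simpa only [Set.inter_univ] using pos_sfineCharge_of_charge F hJK c hS (hKO hV) (hint V hV))
  simpa only [Set.inter_univ] using h

/-! ## §4 The numerator-floor letter of px8 g14's `numFloor_of_chartwise`, a.e. on `O ∩ W`, in its own currency -/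

/-- ★★★ **THE ⟨NUM-FLOOR₁⟩ FIBRE LETTER FROM A POINTWISE CHARGE ON A COMPACT DATUM SET** (docks into px8 g14's `…SmallMassOneStep.numFloor_of_chartwise`, whose
hypothesis reads `∀ᵐ U, U ∈ O ∩ W → ofReal m ≤ ∫⁻ 1_{G ∩ Sfine}(c.Φ(U,z))·c.jac(U,z) dU_K(z)`): window chart `c`, `Sfine` measurable, `G` OPEN, a compact datum set
`Kc ⊆ O` containing `O ∩ W` on which the charge `κ_U(Sfine ∩ G)` is positive ⟹ ONE real `m > 0` with that letter (for every, hence a.e., `U ∈ O ∩ W`).  The pointwise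
positivity is the HYPOTHESIS (a localised chart charge at a fibre point of `G ∩ Sfine`) — NOT proved here. [cite: Balaban1985Averaging, (10) p.19 and Prop. 1 p.22;
Balaban1987RG1, (2.10) p.267] -/
theorem exists_numFib_of_pos (c : WindowChart F hJK Sfine O) (hS : MeasurableSet Sfine)
    {G : Set (GaugeField (F.P K) 0 (Matrix.specialUnitaryGroup (Fin 2) ℂ))} (hG : IsOpen G)
    {Kc : Set (GaugeField (F.P J) 0 (Matrix.specialUnitaryGroup (Fin 2) ℂ))} (hK : IsCompact Kc) (hKO : Kc ⊆ O)
    (hpos : ∀ U ∈ Kc, 0 < ∫⁻ z, (Sfine ∩ G).indicator (fun _ => (1 : ℝ≥0∞)) (c.Φ (U, z)) * (c.jac (U, z) : ℝ≥0∞)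
      ∂(fieldMeasure (F.P K) 0 (Matrix.specialUnitaryGroup (Fin 2) ℂ)))
    (W : Set (GaugeField (F.P J) 0 (Matrix.specialUnitaryGroup (Fin 2) ℂ))) (hWK : O ∩ W ⊆ Kc) :
    ∃ m : ℝ, 0 < m ∧ ∀ᵐ U ∂(fieldMeasure (F.P J) 0 (Matrix.specialUnitaryGroup (Fin 2) ℂ)), U ∈ O ∩ W →
      ENNReal.ofReal m ≤ ∫⁻ z, (G ∩ Sfine).indicator (fun _ => (1 : ℝ≥0∞)) (c.Φ (U, z)) * (c.jac (U, z) : ℝ≥0∞)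
        ∂(fieldMeasure (F.P K) 0 (Matrix.specialUnitaryGroup (Fin 2) ℂ)) := by
  obtain ⟨m, hm, hle⟩ := exists_ofReal_le_of_lowerSemicontinuousOn hK ((lowerSemicontinuousOn_targetCharge F hJK c hS hG).mono hKO) hpos
  refine ⟨m, hm, Filter.Eventually.of_forall fun U hU => ?_⟩
  rw [Set.inter_comm G Sfine]
  exact hle U (hWK hU)

end Summit.QuantumFields.YangMills.Theorems.FluctuationComparisonRegPrIntLChartTargetLscFloor

end
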